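import Mathlib

/-!
# Truncated binomial series of `(1 - z)^{-1/4}`: coefficients, an Abel tail bound, a real bound

Helper file for item stmt-QuantumFields-10699 (`MultibosonBridge.AdmissibleRootsExistR`,
route MultibosonBridge, QCD sub-problem): the two-interval approximation of `1/|t|` by
`|t| ↦ κ ∏ |t - z|²` is built from the truncated binomial series
`f_m(z) = Σ_{n ≤ m} b_n z^n` of `f(z) = (1 - z)^{-1/4} = Σ b_n z^n`, `b_n = (1/4)_n / n!`, i.e.
`b_n = Ring.multichoose (1/4) n` (Mathlib's multiset binomial coefficient).

This file is definition-free and provides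

* `multichoose_quarter_succ` / `_pos` / `_succ_le` and the decay bound
  `multichoose_quarter_pow_four_mul_le : b_n ^ 4 * (n + 1) ^ 3 ≤ 1`;
* `hasSum_multichoose_mul_pow` — `Σ b_n z^n = 1/(1-z)^{1/4}` on the open unit disc (from Mathlib's
  binomial series `Complex.one_div_one_sub_cpow_hasFPowerSeriesOnBall_zero`);
* `norm_quarticInv_pow_four` — `‖1/(1-z)^{1/4}‖⁴ = 1/‖1 - z‖`;
* `norm_one_sub_mul_tail_le` — the Abel (summation by parts) tail bound
  `‖(1 - z) (f(z) - f_m(z))‖ ≤ 2 b_{m+1} ‖z‖^{m+1}`, using only that `b` is positive decreasing;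
* `norm_tail_le_of` — hence `‖f - f_m‖ ≤ 2‖z‖^{m+1} ‖f‖` as soon as `(m+2) ‖1-z‖ ≥ 1`;
* `partialSum_le_rpow` — for real `0 ≤ t < 1`: `Σ_{n≤m} b_n t^n ≤ (1-t)^{-1/4}`.

Elementary; no named facts. No statement about QCD or Yang–Mills is proved here.
-/

noncomputable section

open scoped BigOperators
open Complex Finset Filter Topology

namespace Summit.QuantumFields.QCD.Theorems.MultibosonBridge.AdmissibleRoots

/-! ### The coefficients `b_n = (1/4)_n / n! = Ring.multichoose (1/4) n` -/

/-- `b_n = (1/4)_n / n!`: Mathlib's `Ring.multichoose (1/4) n` is the rising factorial over `n!`. -/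
theorem multichoose_quarter_eq (n : ℕ) :
    Ring.multichoose (1 / 4 : ℝ) n = (ascPochhammer ℝ n).eval (1 / 4 : ℝ) / n.factorial := by
  have h := Ring.factorial_nsmul_multichoose_eq_ascPochhammer (1 / 4 : ℝ) n
  rw [Polynomial.ascPochhammer_smeval_eq_eval, nsmul_eq_mul] at h
  have hf : ((n.factorial : ℕ) : ℝ) ≠ 0 := by positivity
  field_simp
  linarith [h]

/-- `b_0 = 1`. -/
theorem multichoose_quarter_zero : Ring.multichoose (1 / 4 : ℝ) 0 = 1 := by
  simp

/-- The ratio recursion `b_{n+1} = b_n · (n + 1/4)/(n + 1)`. -/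
theorem multichoose_quarter_succ (n : ℕ) :
    Ring.multichoose (1 / 4 : ℝ) (n + 1) =
      Ring.multichoose (1 / 4 : ℝ) n * (((n : ℝ) + 1 / 4) / ((n : ℝ) + 1)) := by
  rw [multichoose_quarter_eq, multichoose_quarter_eq, ascPochhammer_succ_eval, Nat.factorial_succ]
  push_cast
  have h1 : ((n : ℝ) + 1) ≠ 0 := by positivity
  have h2 : ((n.factorial : ℕ) : ℝ) ≠ 0 := by positivity
  field_simp
  ring

/-- `b_n > 0`. -/
theorem multichoose_quarter_pos (n : ℕ) : 0 < Ring.multichoose (1 / 4 : ℝ) n := by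
  induction n with
  | zero => simp
  | succ n ih => rw [multichoose_quarter_succ]; positivity

/-- `b_{n+1} ≤ b_n`. -/
theorem multichoose_quarter_succ_le (n : ℕ) :
    Ring.multichoose (1 / 4 : ℝ) (n + 1) ≤ Ring.multichoose (1 / 4 : ℝ) n := by
  rw [multichoose_quarter_succ]
  have hb := multichoose_quarter_pos n
  have h : (((n : ℝ) + 1 / 4) / ((n : ℝ) + 1)) ≤ 1 := by
    rw [div_le_one (by positivity)]; linarith
  calc Ring.multichoose (1 / 4 : ℝ) n * (((n : ℝ) + 1 / 4) / ((n : ℝ) + 1))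
      ≤ Ring.multichoose (1 / 4 : ℝ) n * 1 := by gcongr
    _ = Ring.multichoose (1 / 4 : ℝ) n := mul_one _

/-- The decay bound `b_n^4 (n+1)^3 ≤ 1` (so `b_n ≤ (n+1)^{-3/4}`), by induction on `n` using the
polynomial inequality `(4n+1)^4 (n+2)^3 ≤ 256 (n+1)^7`. -/
theorem multichoose_quarter_pow_four_mul_le (n : ℕ) :
    Ring.multichoose (1 / 4 : ℝ) n ^ 4 * ((n : ℝ) + 1) ^ 3 ≤ 1 := by
  induction n with
  | zero => simp
  | succ n ih =>
    rw [multichoose_quarter_succ]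
    push_cast
    have hb := multichoose_quarter_pos n
    have hn : (0 : ℝ) ≤ n := Nat.cast_nonneg n
    have key : ((n : ℝ) + 1 / 4) ^ 4 * ((n : ℝ) + 1 + 1) ^ 3 ≤
        ((n : ℝ) + 1) ^ 4 * ((n : ℝ) + 1) ^ 3 := by
      have hD : 0 ≤ 248 + 1652 * (n : ℝ) + 4410 * (n : ℝ) ^ 2 + 5663 * (n : ℝ) ^ 3
          + 3248 * (n : ℝ) ^ 4 + 672 * (n : ℝ) ^ 5 := by positivity
      nlinarith [hD]
    have hpos : 0 < ((n : ℝ) + 1) ^ 4 * ((n : ℝ) + 1) ^ 3 := by positivity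
    calc (Ring.multichoose (1 / 4 : ℝ) n * (((n : ℝ) + 1 / 4) / ((n : ℝ) + 1))) ^ 4 *
          ((n : ℝ) + 1 + 1) ^ 3
        = (Ring.multichoose (1 / 4 : ℝ) n ^ 4 * ((n : ℝ) + 1) ^ 3) *
            ((((n : ℝ) + 1 / 4) ^ 4 * ((n : ℝ) + 1 + 1) ^ 3) /
              (((n : ℝ) + 1) ^ 4 * ((n : ℝ) + 1) ^ 3)) := by
          field_simp
      _ ≤ 1 * 1 := by
          gcongr
          · rw [div_le_one hpos]; exact key
      _ = 1 := one_mul _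

/-- Consequence: `b_N^4 ≤ 1/(N+1)^3`. -/
theorem multichoose_quarter_pow_four_le (N : ℕ) :
    Ring.multichoose (1 / 4 : ℝ) N ^ 4 ≤ 1 / ((N : ℝ) + 1) ^ 3 := by
  rw [le_div_iff₀ (by positivity)]
  simpa using multichoose_quarter_pow_four_mul_le N

/-! ### The binomial series `Σ b_n z^n = (1 - z)^{-1/4}` -/

/-- The binomial series: for `‖z‖ < 1`, `Σ_n b_n z^n = 1/(1-z)^{1/4}` (principal branch). -/
theorem hasSum_multichoose_mul_pow {z : ℂ} (hz : ‖z‖ < 1) :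
    HasSum (fun n : ℕ => ((Ring.multichoose (1 / 4 : ℝ) n : ℝ) : ℂ) * z ^ n)
      (1 / (1 - z) ^ (1 / 4 : ℂ)) := by
  have h := Complex.one_div_one_sub_cpow_hasFPowerSeriesOnBall_zero (1 / 4 : ℂ)
  have hzb : z ∈ Metric.eball (0 : ℂ) 1 := by
    rw [Metric.mem_eball, edist_zero_right, ← ofReal_norm, ENNReal.ofReal_lt_one]
    exact hz
  have hs := h.hasSum hzb
  simp only [FormalMultilinearSeries.ofScalars_apply_eq, zero_add, smul_eq_mul] at hs
  have hfun : (fun n : ℕ => ((Ring.multichoose (1 / 4 : ℝ) n : ℝ) : ℂ) * z ^ n) =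
      (fun n : ℕ => Ring.choose ((1 / 4 : ℂ) + n - 1) n * z ^ n) := by
    funext n
    rw [Ring.multichoose_eq, Complex.ofReal_choose]
    push_cast
    ring_nf
  rw [hfun]
  exact hs

/-- `‖1/(1-z)^{1/4}‖⁴ = 1/‖1-z‖` for `‖z‖ < 1`. -/
theorem norm_quarticInv_pow_four {z : ℂ} (hz : ‖z‖ < 1) :
    ‖1 / (1 - z) ^ (1 / 4 : ℂ)‖ ^ 4 = 1 / ‖1 - z‖ := by
  have hne : (1 : ℂ) - z ≠ 0 := by
    intro h
    have : z = 1 := by linear_combination -h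
    rw [this, norm_one] at hz
    exact lt_irrefl _ hz
  have hpos : 0 < ‖1 - z‖ := norm_pos_iff.mpr hne
  rw [norm_div, norm_one, show (1 / 4 : ℂ) = ((1 / 4 : ℝ) : ℂ) by push_cast; ring,
    Complex.norm_cpow_real, div_pow, one_pow, ← Real.rpow_natCast,
    ← Real.rpow_mul hpos.le]
  norm_num

/-- `‖1/(1-z)^{1/4}‖ > 0` for `‖z‖ < 1`. -/
theorem norm_quarticInv_pos {z : ℂ} (hz : ‖z‖ < 1) : 0 < ‖1 / (1 - z) ^ (1 / 4 : ℂ)‖ := by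
  have hne : (1 : ℂ) - z ≠ 0 := by
    intro h
    have : z = 1 := by linear_combination -h
    rw [this, norm_one] at hz
    exact lt_irrefl _ hz
  refine norm_pos_iff.mpr (div_ne_zero one_ne_zero ?_)
  rw [Ne, Complex.cpow_eq_zero_iff, not_and_or]
  exact Or.inl hne

/-! ### Partial sums and the Abel tail bound -/

/-- Summation by parts (finite Abel identity): for any sequence `c` and any `w`,
`(1 - w) Σ_{k ≤ N} c_k w^k = c_0 - c_N w^{N+1} - Σ_{k < N} (c_k - c_{k+1}) w^{k+1}`. -/
theorem abel_identity (c : ℕ → ℂ) (w : ℂ) (N : ℕ) :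
    (1 - w) * ∑ k ∈ range (N + 1), c k * w ^ k =
      c 0 - c N * w ^ (N + 1) - ∑ k ∈ range N, (c k - c (k + 1)) * w ^ (k + 1) := by
  induction N with
  | zero => simp; ring
  | succ N ih =>
    rw [sum_range_succ, mul_add, ih, sum_range_succ]
    ring

/-- Abel bound: for a nonnegative decreasing real sequence `c` and `‖w‖ ≤ 1`,
`‖(1 - w) Σ_{k ≤ N} c_k w^k‖ ≤ 2 c_0`. -/
theorem norm_abel_le (c : ℕ → ℝ) (hc0 : ∀ k, 0 ≤ c k) (hc : ∀ k, c (k + 1) ≤ c k)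
    {w : ℂ} (hw : ‖w‖ ≤ 1) (N : ℕ) :
    ‖(1 - w) * ∑ k ∈ range (N + 1), (c k : ℂ) * w ^ k‖ ≤ 2 * c 0 := by
  rw [abel_identity (fun k => (c k : ℂ)) w N]
  have h1 : ‖(c 0 : ℂ)‖ = c 0 := by rw [norm_real, Real.norm_of_nonneg (hc0 0)]
  have h2 : ‖(c N : ℂ) * w ^ (N + 1)‖ ≤ c N := by
    rw [norm_mul, norm_real, Real.norm_of_nonneg (hc0 N), norm_pow]
    calc c N * ‖w‖ ^ (N + 1) ≤ c N * 1 := by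
          gcongr
          · exact hc0 N
          · exact pow_le_one₀ (norm_nonneg _) hw
      _ = c N := mul_one _
  have h3 : ‖∑ k ∈ range N, ((c k : ℂ) - (c (k + 1) : ℂ)) * w ^ (k + 1)‖ ≤ c 0 - c N := by
    calc ‖∑ k ∈ range N, ((c k : ℂ) - (c (k + 1) : ℂ)) * w ^ (k + 1)‖
        ≤ ∑ k ∈ range N, ‖((c k : ℂ) - (c (k + 1) : ℂ)) * w ^ (k + 1)‖ := norm_sum_le _ _
      _ ≤ ∑ k ∈ range N, (c k - c (k + 1)) := by
          refine sum_le_sum fun k _ => ?_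
          rw [norm_mul, ← ofReal_sub, norm_real, Real.norm_of_nonneg (by linarith [hc k]),
            norm_pow]
          calc (c k - c (k + 1)) * ‖w‖ ^ (k + 1) ≤ (c k - c (k + 1)) * 1 := by
                gcongr
                · linarith [hc k]
                · exact pow_le_one₀ (norm_nonneg _) hw
            _ = c k - c (k + 1) := mul_one _
      _ = c 0 - c N := sum_range_sub' c N
  calc ‖(c 0 : ℂ) - (c N : ℂ) * w ^ (N + 1) -
        ∑ k ∈ range N, ((c k : ℂ) - (c (k + 1) : ℂ)) * w ^ (k + 1)‖
      ≤ ‖(c 0 : ℂ) - (c N : ℂ) * w ^ (N + 1)‖ +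
          ‖∑ k ∈ range N, ((c k : ℂ) - (c (k + 1) : ℂ)) * w ^ (k + 1)‖ := norm_sub_le _ _
    _ ≤ (‖(c 0 : ℂ)‖ + ‖(c N : ℂ) * w ^ (N + 1)‖) +
          ‖∑ k ∈ range N, ((c k : ℂ) - (c (k + 1) : ℂ)) * w ^ (k + 1)‖ := by
          gcongr; exact norm_sub_le _ _
    _ ≤ (c 0 + c N) + (c 0 - c N) := by gcongr; exact h1.le
    _ = 2 * c 0 := by ring

/-- The tail of the binomial series from `m+1`:
`HasSum (k ↦ b_{k+m+1} z^{k+m+1}) (f(z) - f_m(z))`. -/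
theorem hasSum_tail {z : ℂ} (hz : ‖z‖ < 1) (m : ℕ) :
    HasSum (fun k : ℕ => ((Ring.multichoose (1 / 4 : ℝ) (k + (m + 1)) : ℝ) : ℂ) * z ^ (k + (m + 1)))
      (1 / (1 - z) ^ (1 / 4 : ℂ) -
        ∑ n ∈ range (m + 1), ((Ring.multichoose (1 / 4 : ℝ) n : ℝ) : ℂ) * z ^ n) :=
  (hasSum_nat_add_iff' (f := fun n : ℕ => ((Ring.multichoose (1 / 4 : ℝ) n : ℝ) : ℂ) * z ^ n)
    (m + 1)).mpr (hasSum_multichoose_mul_pow hz)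

/-- **Abel tail bound.** For `‖z‖ < 1`: `‖(1 - z)(f(z) - f_m(z))‖ ≤ 2 b_{m+1} ‖z‖^{m+1}`. -/
theorem norm_one_sub_mul_tail_le {z : ℂ} (hz : ‖z‖ < 1) (m : ℕ) :
    ‖(1 - z) * (1 / (1 - z) ^ (1 / 4 : ℂ) -
        ∑ n ∈ range (m + 1), ((Ring.multichoose (1 / 4 : ℝ) n : ℝ) : ℂ) * z ^ n)‖ ≤
      2 * Ring.multichoose (1 / 4 : ℝ) (m + 1) * ‖z‖ ^ (m + 1) := by
  have hT := hasSum_tail hz m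
  set r := 1 / (1 - z) ^ (1 / 4 : ℂ) -
        ∑ n ∈ range (m + 1), ((Ring.multichoose (1 / 4 : ℝ) n : ℝ) : ℂ) * z ^ n with hr
  set c : ℕ → ℝ := fun k => Ring.multichoose (1 / 4 : ℝ) (k + (m + 1)) with hc
  have hS : Tendsto (fun N : ℕ => ∑ k ∈ range N,
      ((Ring.multichoose (1 / 4 : ℝ) (k + (m + 1)) : ℝ) : ℂ) * z ^ (k + (m + 1))) atTop (𝓝 r) :=
    hT.tendsto_sum_nat
  have hS' : Tendsto (fun N : ℕ => ‖(1 - z) * ∑ k ∈ range (N + 1),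
      ((Ring.multichoose (1 / 4 : ℝ) (k + (m + 1)) : ℝ) : ℂ) * z ^ (k + (m + 1))‖)
      atTop (𝓝 ‖(1 - z) * r‖) := by
    have h2 := hS.comp (tendsto_add_atTop_nat 1)
    exact (((continuous_const.mul continuous_id).tendsto _).comp h2).norm
  refine le_of_tendsto' hS' fun N => ?_
  have hrw : ∑ k ∈ range (N + 1),
      ((Ring.multichoose (1 / 4 : ℝ) (k + (m + 1)) : ℝ) : ℂ) * z ^ (k + (m + 1)) =
      z ^ (m + 1) * ∑ k ∈ range (N + 1), (c k : ℂ) * z ^ k := by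
    rw [mul_sum]
    refine sum_congr rfl fun k _ => ?_
    rw [hc, pow_add]
    push_cast
    ring
  rw [hrw, mul_left_comm, norm_mul, norm_pow]
  have hA := norm_abel_le c (fun k => (multichoose_quarter_pos _).le) (fun k => by
    simpa [hc, Nat.add_right_comm] using multichoose_quarter_succ_le (k + (m + 1))) hz.le N
  have hc0 : c 0 = Ring.multichoose (1 / 4 : ℝ) (m + 1) := by simp [hc]
  rw [hc0] at hA
  calc ‖z‖ ^ (m + 1) * ‖(1 - z) * ∑ k ∈ range (N + 1), (c k : ℂ) * z ^ k‖
      ≤ ‖z‖ ^ (m + 1) * (2 * Ring.multichoose (1 / 4 : ℝ) (m + 1)) := by gcongr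
    _ = 2 * Ring.multichoose (1 / 4 : ℝ) (m + 1) * ‖z‖ ^ (m + 1) := by ring

/-- **Relative tail bound.** If `‖z‖ < 1` and `(m + 2) ‖1 - z‖ ≥ 1` then
`‖f(z) - f_m(z)‖ ≤ 2 ‖z‖^{m+1} ‖f(z)‖` (the decay `b_{m+1} ≤ (m+2)^{-3/4}` compensates
`‖f‖³ = ‖1-z‖^{-3/4}`). -/
theorem norm_tail_le_of {z : ℂ} (hz : ‖z‖ < 1) (m : ℕ) (hm : 1 ≤ ((m : ℝ) + 2) * ‖1 - z‖) :
    ‖1 / (1 - z) ^ (1 / 4 : ℂ) -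
        ∑ n ∈ range (m + 1), ((Ring.multichoose (1 / 4 : ℝ) n : ℝ) : ℂ) * z ^ n‖ ≤
      2 * ‖z‖ ^ (m + 1) * ‖1 / (1 - z) ^ (1 / 4 : ℂ)‖ := by
  have hne : (1 : ℂ) - z ≠ 0 := by
    intro h
    have : z = 1 := by linear_combination -h
    rw [this, norm_one] at hz
    exact lt_irrefl _ hz
  have hd : 0 < ‖1 - z‖ := norm_pos_iff.mpr hne
  set r := 1 / (1 - z) ^ (1 / 4 : ℂ) -
        ∑ n ∈ range (m + 1), ((Ring.multichoose (1 / 4 : ℝ) n : ℝ) : ℂ) * z ^ n with hr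
  have h1 : ‖r‖ ≤ 2 * Ring.multichoose (1 / 4 : ℝ) (m + 1) * ‖z‖ ^ (m + 1) / ‖1 - z‖ := by
    rw [le_div_iff₀ hd, mul_comm, ← norm_mul]
    exact norm_one_sub_mul_tail_le hz m
  have hρ : 0 ≤ ‖z‖ ^ (m + 1) := by positivity
  have hb : Ring.multichoose (1 / 4 : ℝ) (m + 1) ^ 4 ≤ 1 / (((m + 1 : ℕ) : ℝ) + 1) ^ 3 :=
    multichoose_quarter_pow_four_le (m + 1)
  push_cast at hb
  have hf4 : ‖1 / (1 - z) ^ (1 / 4 : ℂ)‖ ^ 4 = 1 / ‖1 - z‖ := norm_quarticInv_pow_four hz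
  have hbpos := multichoose_quarter_pos (m + 1)
  have key : ‖r‖ ^ 4 ≤ (2 * ‖z‖ ^ (m + 1) * ‖1 / (1 - z) ^ (1 / 4 : ℂ)‖) ^ 4 := by
    have h2 : ‖r‖ ^ 4 ≤
        (2 * Ring.multichoose (1 / 4 : ℝ) (m + 1) * ‖z‖ ^ (m + 1) / ‖1 - z‖) ^ 4 := by
      gcongr
    refine h2.trans ?_
    rw [mul_pow, mul_pow, hf4, div_pow, mul_pow, mul_pow]
    have hm3 : 1 ≤ (((m : ℝ) + 1 + 1) * ‖1 - z‖) ^ 3 := by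
      have : (1 : ℝ) ≤ ((m : ℝ) + 1 + 1) * ‖1 - z‖ := by linarith
      exact one_le_pow₀ this
    rw [div_le_iff₀ (by positivity)]
    calc (2 : ℝ) ^ 4 * Ring.multichoose (1 / 4 : ℝ) (m + 1) ^ 4 * (‖z‖ ^ (m + 1)) ^ 4
        ≤ (2 : ℝ) ^ 4 * (1 / ((m : ℝ) + 1 + 1) ^ 3) * (‖z‖ ^ (m + 1)) ^ 4 := by gcongr
      _ ≤ (2 : ℝ) ^ 4 * (1 / ((m : ℝ) + 1 + 1) ^ 3) * (‖z‖ ^ (m + 1)) ^ 4 *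
            (((m : ℝ) + 1 + 1) * ‖1 - z‖) ^ 3 :=
          le_mul_of_one_le_right (by positivity) hm3
      _ = (2 : ℝ) ^ 4 * (‖z‖ ^ (m + 1)) ^ 4 * (1 / ‖1 - z‖) * ‖1 - z‖ ^ 4 := by
            field_simp
  exact (pow_le_pow_iff_left₀ (norm_nonneg _) (by positivity) (by norm_num : (4 : ℕ) ≠ 0)).mp key

/-! ### The real series on `[0, 1)` -/

/-- For real `0 ≤ t < 1`: `Σ b_n t^n = (1 - t)^{-1/4}`. -/
theorem hasSum_multichoose_mul_pow_real {t : ℝ} (ht0 : 0 ≤ t) (ht1 : t < 1) :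
    HasSum (fun n : ℕ => Ring.multichoose (1 / 4 : ℝ) n * t ^ n) ((1 - t) ^ (-(1 / 4 : ℝ))) := by
  have hz : ‖(t : ℂ)‖ < 1 := by
    rw [norm_real, Real.norm_of_nonneg ht0]; exact ht1
  have h := hasSum_multichoose_mul_pow hz
  have hval : (1 : ℂ) / (1 - (t : ℂ)) ^ (1 / 4 : ℂ) = (((1 - t) ^ (-(1 / 4 : ℝ)) : ℝ) : ℂ) := by
    rw [Real.rpow_neg (by linarith), show (1 / 4 : ℂ) = ((1 / 4 : ℝ) : ℂ) by push_cast; ring,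
      ← ofReal_one, ← ofReal_sub, ← Complex.ofReal_cpow (by linarith)]
    push_cast
    ring
  rw [hval] at h
  have h' : HasSum (fun n : ℕ => ((Ring.multichoose (1 / 4 : ℝ) n * t ^ n : ℝ) : ℂ))
      ((((1 - t) ^ (-(1 / 4 : ℝ)) : ℝ) : ℂ)) := by
    convert h using 2 with n
    push_cast; ring
  exact Complex.hasSum_ofReal.mp h'

/-- For real `0 ≤ t < 1` the truncated series is below the full one:
`Σ_{n ≤ m} b_n t^n ≤ (1 - t)^{-1/4}`. -/
theorem partialSum_le_rpow {t : ℝ} (ht0 : 0 ≤ t) (ht1 : t < 1) (m : ℕ) :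
    ∑ n ∈ range (m + 1), Ring.multichoose (1 / 4 : ℝ) n * t ^ n ≤ (1 - t) ^ (-(1 / 4 : ℝ)) := by
  refine sum_le_hasSum (range (m + 1)) (fun n _ => ?_) (hasSum_multichoose_mul_pow_real ht0 ht1)
  exact mul_nonneg (multichoose_quarter_pos n).le (pow_nonneg ht0 n)

/-- The real partial sum is nonnegative for `t ≥ 0`. -/
theorem partialSum_real_nonneg {t : ℝ} (ht0 : 0 ≤ t) (m : ℕ) :
    0 ≤ ∑ n ∈ range (m + 1), Ring.multichoose (1 / 4 : ℝ) n * t ^ n :=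
  sum_nonneg fun n _ => mul_nonneg (multichoose_quarter_pos n).le (pow_nonneg ht0 n)

end Summit.QuantumFields.QCD.Theorems.MultibosonBridge.AdmissibleRoots

end
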